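import Summits.Ventures.Crystal3D.Bulk.GapActiveHemisphere
import Summits.Ventures.Crystal3D.Bulk.GapHullEulerCensus
import HarnessLib

/-!
# The ACTIVE hull `D°`: the hull fan of the active directions is an admissible ambient fan for
# the tight map (route 1 of `HOME/lean/lemmaL/DESIGN.md`, step R1.1)

HONEST FRAMING. Part of the venture `Summits/Ventures/Crystal3D` (cell `pub-crystal3d`, phase 2;
seat p3). Kernel lemmas; nothing here asserts anything about GAP(1.26). LEMMA L of the cell's
`DESIGN-L12-THEORY.md` (faces of the tight graph `T′` are convex) is an ear induction over the
hull triangulation `D°` of the ACTIVE directions (non-rattler shell balls + hole), which — unlike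
the hull fan of all thirteen directions `dirSet c` — has NO vertex interior to a face. This file
sets `D°` up as an instance of the `X`-generic wiring (`Bulk/GapSubHullRotation.lean`,
hypotheses: unit vectors, `0` interior to the hull, every tight dart a hull dart):

* `activeDirSet c = (activeVertices c).image (gapDir c)` ⊆ `dirSet c`; unit vectors; under the
  census rows `0 ∈ interior (conv (activeDirSet c))` (`Bulk/GapActiveHemisphere.lean`, L3);
* `mem_hullEdges_of_subset` (generic): an exposed edge of `conv X` with both ends in `Y ⊆ X` is
  an exposed edge of `conv Y` (same edge normal);
* **`CensusRows.pair_mem_hullEdges_activeDirSet`** — every tight pair spans a hull edge of the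
  ACTIVE hull (tight pairs are exposed edges of the full hull, `pair_mem_hullEdges_of_tight`,
  and both ends are active); hence **`CensusRows.dirPair_mem_hullDarts_active`**: every tight
  dart is a dart of the fan triangulation of `activeDirSet c` — hypothesis `hT` of the generic
  wiring — and `CensusRows.tight_subset_fanNbrs_active`.
-/

noncomputable section

open scoped InnerProductSpace

namespace Summit.Ventures.Crystal3D

open Literature.Geometry.DiscreteGeometry Finset HullRotSys

variable {c : Fin 14 → EuclideanSpace ℝ (Fin 3)}

/-! ## Hull edges restrict to subsets -/

/-- **An exposed edge with both ends in a subset is an exposed edge of the subset** (the same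
edge normal exposes it). -/
theorem mem_hullEdges_of_subset {X Y T : Finset (EuclideanSpace ℝ (Fin 3))} (hYX : Y ⊆ X)
    (hT : T ∈ hullEdges X) (hTY : T ⊆ Y) : T ∈ hullEdges Y := by
  obtain ⟨c₀, ⟨hle, hcard⟩, rfl⟩ := mem_hullEdges.1 hT
  have heq : tightSet Y c₀ = tightSet X c₀ := by
    ext y
    rw [mem_tightSet, mem_tightSet]
    constructor
    · rintro ⟨hy, h1⟩; exact ⟨hYX hy, h1⟩
    · rintro ⟨hy, h1⟩; exact ⟨hTY (mem_tightSet.2 ⟨hy, h1⟩), h1⟩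
  refine mem_hullEdges.2 ⟨c₀, ⟨fun y hy => hle y (hYX hy), ?_⟩, heq⟩
  rw [heq]; exact hcard

/-! ## The active direction set -/

/-- **The active direction set** `D°`: the directions of the active vertices (balls `≠ 0` with a
tight partner — the non-rattler shell balls and the hole). -/
def activeDirSet (c : Fin 14 → EuclideanSpace ℝ (Fin 3)) : Finset (EuclideanSpace ℝ (Fin 3)) :=
  (activeVertices c).image (gapDir c)

/-- Membership in `activeDirSet`. -/
theorem mem_activeDirSet {y : EuclideanSpace ℝ (Fin 3)} :
    y ∈ activeDirSet c ↔ ∃ i ∈ activeVertices c, gapDir c i = y := by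
  unfold activeDirSet; rw [mem_image]

/-- The direction of an active vertex is in the active direction set. -/
theorem gapDir_mem_activeDirSet {i : Fin 14} (hi : i ∈ activeVertices c) :
    gapDir c i ∈ activeDirSet c :=
  mem_activeDirSet.2 ⟨i, hi, rfl⟩

/-- The active directions are among the thirteen directions. -/
theorem activeDirSet_subset_dirSet (c : Fin 14 → EuclideanSpace ℝ (Fin 3)) :
    activeDirSet c ⊆ dirSet c := by
  intro y hy
  obtain ⟨i, hi, rfl⟩ := mem_activeDirSet.1 hy
  exact gapDir_mem_dirSet (mem_activeVertices.1 hi).1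

/-- The active directions are unit vectors. -/
theorem IsGapConfig.norm_of_mem_activeDirSet (hc : IsGapConfig c) :
    ∀ y ∈ activeDirSet c, ‖y‖ = 1 :=
  fun y hy => hc.norm_of_mem_dirSet y (activeDirSet_subset_dirSet c hy)

/-- **`0` is interior to the hull of the active directions** (L3, `Bulk/GapActiveHemisphere`). -/
theorem CensusRows.zero_mem_interior_convexHull_activeDirSet (h : CensusRows c) :
    (0 : EuclideanSpace ℝ (Fin 3)) ∈
      interior (convexHull ℝ (activeDirSet c : Set (EuclideanSpace ℝ (Fin 3)))) :=
  h.zero_mem_interior_convexHull_activeDirs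

/-- The tail of a dart is active, so its direction is an active direction. -/
theorem gapDir_fst_mem_activeDirSet {q : Fin 14 × Fin 14} (hq : q ∈ darts c) :
    gapDir c q.1 ∈ activeDirSet c := by
  refine gapDir_mem_activeDirSet ?_
  rw [← image_fst_darts]; exact mem_image_of_mem _ hq

/-- The head of a dart is active, so its direction is an active direction. -/
theorem gapDir_snd_mem_activeDirSet {q : Fin 14 × Fin 14} (hq : q ∈ darts c) :
    gapDir c q.2 ∈ activeDirSet c := by
  have := gapDir_fst_mem_activeDirSet (swap_mem_darts hq)
  simpa only [Prod.fst_swap] using this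

/-! ## Tight pairs are hull edges, and tight darts are hull darts, of the ACTIVE hull -/

/-- **Every tight pair spans a hull edge of the active hull** (`intruderDist c < 3/2`): the edge
normal exposing it in `conv (dirSet c)` exposes it in `conv (activeDirSet c)`. -/
theorem IsGapConfig.pair_mem_hullEdges_activeDirSet (hc : IsGapConfig c)
    (hD : intruderDist c < 3 / 2) {q : Fin 14 × Fin 14} (hq : q ∈ darts c) :
    ({gapDir c q.1, gapDir c q.2} : Finset (EuclideanSpace ℝ (Fin 3))) ∈
      hullEdges (activeDirSet c) := by
  obtain ⟨hi0, hj0, -, hd⟩ := mem_darts.1 hq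
  refine mem_hullEdges_of_subset (activeDirSet_subset_dirSet c)
    (hc.pair_mem_hullEdges_of_tight hD hi0 hj0 hd) ?_
  rw [insert_subset_iff, singleton_subset_iff]
  exact ⟨gapDir_fst_mem_activeDirSet hq, gapDir_snd_mem_activeDirSet hq⟩

/-- **Every tight dart is a dart of the fan triangulation of the active hull** — hypothesis
`hT` of the `X`-generic wiring for `X = activeDirSet c` — given `0` interior to that hull. -/
theorem IsGapConfig.dirPair_mem_hullDarts_active_of (hc : IsGapConfig c)
    (hD : intruderDist c < 3 / 2)
    (h0 : (0 : EuclideanSpace ℝ (Fin 3)) ∈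
      interior (convexHull ℝ (activeDirSet c : Set (EuclideanSpace ℝ (Fin 3)))))
    {q : Fin 14 × Fin 14} (hq : q ∈ darts c) : dirPair c q ∈ hullDarts (activeDirSet c) := by
  have hD2 : intruderDist c < 2 := by linarith
  obtain ⟨hi0, hj0, hij, -⟩ := mem_darts.1 hq
  have h2 := card_filter_fanTriSets_eq_two_of_mem_hullEdges hc.norm_of_mem_activeDirSet h0
    (hc.pair_mem_hullEdges_activeDirSet hD hq)
  obtain ⟨t, ht⟩ : ((fanTriSets (activeDirSet c)).filter fun t' =>
      ({gapDir c q.1, gapDir c q.2} : Finset _) ⊆ t').Nonempty := by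
    rw [← Finset.card_pos, h2]; exact Nat.succ_pos 1
  rw [mem_filter, insert_subset_iff, singleton_subset_iff] at ht
  exact mk_mem_hullDarts ht.1 ht.2.1 ht.2.2 (hc.gapDir_ne hD2 hi0 hj0 hij)

/-- **At a census configuration every tight dart is a dart of the active hull fan.** -/
theorem CensusRows.dirPair_mem_hullDarts_active (h : CensusRows c) :
    ∀ q ∈ darts c, dirPair c q ∈ hullDarts (activeDirSet c) :=
  fun _ hq => h.isGapConfig.dirPair_mem_hullDarts_active_of h.intruderDist_lt_three_halves
    h.zero_mem_interior_convexHull_activeDirSet hq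

/-- Hence the tight partners of a ball are among its fan neighbours in the ACTIVE hull. -/
theorem CensusRows.tight_subset_fanNbrs_active (h : CensusRows c) {i : Fin 14} (hi0 : i ≠ 0) :
    (tightNbrs c i).image (gapDir c) ⊆ fanNbrs (activeDirSet c) (gapDir c i) := by
  intro y hy
  obtain ⟨j, hj, rfl⟩ := mem_image.1 hy
  exact mk_mem_hullDarts_iff.1 (h.dirPair_mem_hullDarts_active (i, j) (mk_mem_darts hi0 hj))

/-- The active hull has at least the four vertices hole + its (≥ 3) contacts; in particular it
is nonempty. -/
theorem CensusRows.activeDirSet_nonempty (h : CensusRows c) : (activeDirSet c).Nonempty :=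
  ⟨gapDir c 13, gapDir_mem_activeDirSet h.thirteen_mem_activeVertices⟩

end Summit.Ventures.Crystal3D
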